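import Literature.Analysis.FluidPDE.PassiveScalarDiagDuhamelBound
import Literature.Analysis.FluidPDE.PassiveScalarDiagExistence
import Literature.Analysis.FluidPDE.PassiveScalarDiagForcedLinear
import Literature.Analysis.FluidPDE.PassiveScalarDiagRestart
import Literature.Analysis.FluidPDE.UniversalTotalAnomalousDissipatorProofs
import HarnessLib

/-!
# Scalar zeroth law over a prescribed carrier — the estimates of one period

Cell `ad-ideate`, planner ad-ideate-p1 ROUND-10 §B3, Step 1, for an `L²`-CONTINUOUS global
weak solution `w` of `∂ₜθ + b·∇θ = κ ∑ᵢ aᵢ ∂ᵢ∂ᵢθ + S` (`Torus.IsWeakScalarTransportDiagForced`,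
`Torus.IsL2ContinuousOn (Ici 0) w` — every weak solution has such a representative,
`IsWeakScalarTransportDiagForced.exists_l2Continuous_representative`), with a bounded drift `b`
which on the active unit `[nL, nL + 1]` of every period is the Hess-Childs–Rowan field `W` and on
the quiet part `[nL + 1, (n+1)L]` vanishes, a steady smooth mean-zero source `S`, `κ > 0`,
`aᵢ > 0`, mean-zero `L²` datum. Writing `N(t) = ‖w(t)‖_{L²}`, `σ_S = ‖S‖_{L²}`:

* `sqrt_integral_sq_le_add_mul` — `N(t₂) ≤ N(t₁) + (t₂ - t₁) σ_S` for `0 ≤ t₁ ≤ t₂`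
  (the tree's Duhamel bound `sqrt_integral_sq_le_of_isL2ContinuousOn`);
* `sqrt_integral_sq_activeEnd_le` — **the charge–discharge contraction**
  `N(nL + 1) ≤ q N(nL) + σ_S`, where `q²` is the `L² → L²` bound of the unit-time solution map of
  the homogeneous problem with drift `W` on `L²`-continuous weak solutions with mean-zero data (the
  hypothesis `hHCR`; Hess-Childs–Rowan Cor. 1.3 (1.3), `p = 2`): split `w(nL + ·) = θʰ + θᶠ` with
  `θʰ` the `L²`-continuous homogeneous solution from `w(nL)` (`PassiveScalarDiagExistence`) and
  `θᶠ` the forced remainder from datum `0` (`sub_homogeneous`), `‖θᶠ(1)‖ ≤ σ_S` (Duhamel);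
* the injection estimates of the quiet and active phases (Steps 3–4) are in the companion file
  `ScalarZerothLawKinematicInjection.lean`.

Supports stmt-AnomalousDissipation-0448 (prescribed-carrier rung; no statement about Navier–Stokes).
-/

noncomputable section

-- `Summit.<Summit>.<Problem>` is the tree's mandated summit-side namespace (CONVENTIONS §2); for this
-- single-conjunct summit the two coincide, so the duplicate is deliberate.
set_option linter.dupNamespace false

namespace Summit.AnomalousDissipation.AnomalousDissipation.Theorems.ScalarZerothLawKinematic

open MeasureTheory Set Filter Topology
open scoped NNReal ENNReal InnerProductSpace
open Literature.Analysis Literature.Analysis.FluidPDE Literature.Analysis.FunctionSpaces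
open Literature.Analysis.FluidPDE.Torus Literature.Analysis.FunctionSpaces.Torus

/-! ## `L²` tools -/

section Tools

variable {d : Type*} [Fintype d]

/-- Cauchy–Schwarz in `L²(T^d)`: `|∫ f g| ≤ √(∫ f²) √(∫ g²)` (a private copy of
`Torus.DEIJ.abs_integral_mul_le_sqrt`, to keep the import cone small). -/
private theorem abs_integral_mul_le_sqrt_integral_sq {f g : UnitAddTorus d → ℝ} (hf : MemLp f 2 volume)
    (hg : MemLp g 2 volume) :
    |∫ x, f x * g x| ≤ Real.sqrt (∫ x, f x ^ 2) * Real.sqrt (∫ x, g x ^ 2) := by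
  -- adapted from `Torus.DEIJ.abs_integral_mul_le_sqrt` (DEIJCriterion.lean)
  have hf' : MemLp f (ENNReal.ofReal 2) volume := by rwa [ENNReal.ofReal_ofNat]
  have hg' : MemLp g (ENNReal.ofReal 2) volume := by rwa [ENNReal.ofReal_ofNat]
  have h := integral_mul_norm_le_Lp_mul_Lq (μ := volume) Real.HolderConjugate.two_two hf' hg'
  have e2 : ∀ (w : UnitAddTorus d → ℝ), (∫ a, ‖w a‖ ^ (2 : ℝ)) ^ (1 / (2 : ℝ)) = Real.sqrt (∫ a, w a ^ 2) := by
    intro w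
    rw [Real.sqrt_eq_rpow]
    congr 1
    refine integral_congr_ae (Eventually.of_forall fun a => ?_)
    dsimp only
    rw [Real.rpow_two, Real.norm_eq_abs, sq_abs]
  rw [e2, e2] at h
  refine le_trans ?_ h
  calc |∫ x, f x * g x| ≤ ∫ x, |f x * g x| := abs_integral_le_integral_abs
    _ = ∫ x, ‖f x‖ * ‖g x‖ := integral_congr_ae (Eventually.of_forall fun x => by
        simp [abs_mul, Real.norm_eq_abs])

/-- The triangle inequality in `L²(T^d)` for `√(∫ ·²)`: `‖f + g‖ ≤ ‖f‖ + ‖g‖`. -/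
theorem sqrt_integral_add_sq_le {f g : UnitAddTorus d → ℝ} (hf : MemLp f 2 volume)
    (hg : MemLp g 2 volume) :
    Real.sqrt (∫ x, (f x + g x) ^ 2) ≤ Real.sqrt (∫ x, f x ^ 2) + Real.sqrt (∫ x, g x ^ 2) := by
  set F : ℝ := Real.sqrt (∫ x, f x ^ 2) with hF
  set G : ℝ := Real.sqrt (∫ x, g x ^ 2) with hG
  have hF0 : 0 ≤ F := Real.sqrt_nonneg _
  have hG0 : 0 ≤ G := Real.sqrt_nonneg _
  have hF2 : F ^ 2 = ∫ x, f x ^ 2 := Real.sq_sqrt (integral_nonneg fun x => sq_nonneg _)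
  have hG2 : G ^ 2 = ∫ x, g x ^ 2 := Real.sq_sqrt (integral_nonneg fun x => sq_nonneg _)
  have hfg := abs_integral_mul_le_sqrt_integral_sq hf hg
  have hi_f2 : Integrable (fun x => f x ^ 2) volume := hf.integrable_sq
  have hi_g2 : Integrable (fun x => g x ^ 2) volume := hg.integrable_sq
  have hi_fg : Integrable (fun x => f x * g x) volume := hf.integrable_mul hg
  have hi_12 : Integrable (fun x => f x ^ 2 + 2 * (f x * g x)) volume := hi_f2.add (hi_fg.const_mul 2)
  have e : ∫ x, (f x + g x) ^ 2 = (∫ x, f x ^ 2) + 2 * (∫ x, f x * g x) + ∫ x, g x ^ 2 := by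
    have e1 : (fun x => (f x + g x) ^ 2) = fun x => (f x ^ 2 + 2 * (f x * g x)) + g x ^ 2 := by
      funext x; ring
    rw [e1, integral_add hi_12 hi_g2, integral_add hi_f2 (hi_fg.const_mul 2), integral_const_mul]
  have hle : ∫ x, (f x + g x) ^ 2 ≤ (F + G) ^ 2 := by
    rw [e, add_sq, hF2, hG2]
    have := le_abs_self (∫ x, f x * g x)
    nlinarith
  calc Real.sqrt (∫ x, (f x + g x) ^ 2) ≤ Real.sqrt ((F + G) ^ 2) := Real.sqrt_le_sqrt hle
    _ = F + G := Real.sqrt_sq (by positivity)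

/-- Time translates of a `C([0,∞); L²)` field are `C([0,T]; L²)` fields. -/
theorem isL2ContinuousOn_shift {θ : ℝ → UnitAddTorus d → ℝ} (h : IsL2ContinuousOn (Ici 0) θ)
    {σ : ℝ} (hσ : 0 ≤ σ) (T : ℝ) : IsL2ContinuousOn (Icc 0 T) fun t => θ (σ + t) := by
  have hmaps : MapsTo (fun t : ℝ => σ + t) (Icc 0 T) (Ici 0) := fun t ht => by
    simp only [mem_Ici]; linarith [ht.1]
  refine ⟨fun t ht => h.memLp (hmaps ht), fun t₀ ht₀ => ?_⟩
  have h0 := h.tendsto (hmaps ht₀)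
  have hcont : Tendsto (fun t : ℝ => σ + t) (𝓝[Icc 0 T] t₀) (𝓝[Ici 0] (σ + t₀)) :=
    ((continuous_const.add continuous_id).continuousWithinAt).tendsto_nhdsWithin hmaps
  exact h0.comp hcont

/-- Differences of `C(S; L²)` fields are `C(S; L²)` fields. -/
theorem isL2ContinuousOn_sub {S : Set ℝ} {f g : ℝ → UnitAddTorus d → ℝ} (hf : IsL2ContinuousOn S f)
    (hg : IsL2ContinuousOn S g) : IsL2ContinuousOn S fun t x => f t x - g t x := by
  refine ⟨fun t ht => (hf.memLp ht).sub (hg.memLp ht), fun t₀ ht₀ => ?_⟩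
  have hlim : Tendsto (fun t => 2 * Torus.scalarL2Sq (f t - f t₀) + 2 * Torus.scalarL2Sq (g t - g t₀))
      (𝓝[S] t₀) (𝓝 (2 * 0 + 2 * 0)) :=
    ((hf.tendsto ht₀).const_mul 2).add ((hg.tendsto ht₀).const_mul 2)
  rw [mul_zero, add_zero] at hlim
  refine squeeze_zero' (Eventually.of_forall fun t => Torus.scalarL2Sq_nonneg _) ?_ hlim
  filter_upwards [self_mem_nhdsWithin] with t ht
  have hi1 : Integrable (fun x => (f t - f t₀) x ^ 2) volume := ((hf.memLp ht).sub (hf.memLp ht₀)).integrable_sq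
  have hi2 : Integrable (fun x => (g t - g t₀) x ^ 2) volume := ((hg.memLp ht).sub (hg.memLp ht₀)).integrable_sq
  simp only [Torus.scalarL2Sq]
  rw [← integral_const_mul, ← integral_const_mul, ← integral_add (hi1.const_mul 2) (hi2.const_mul 2)]
  refine integral_mono_of_nonneg (Eventually.of_forall fun x => sq_nonneg _)
    ((hi1.const_mul 2).add (hi2.const_mul 2)) (Eventually.of_forall fun x => ?_)
  simp only [Pi.sub_apply]
  nlinarith [sq_nonneg ((f t x - f t₀ x) + (g t x - g t₀ x))]

end Tools

/-! ## The setting of one period -/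

section Period

variable {d : Type*} [Fintype d] [DecidableEq d]
  {a : d → ℝ} {κ L A q : ℝ} {b W : ℝ → UnitAddTorus d → EuclideanSpace ℝ d}
  {S θ₀ : UnitAddTorus d → ℝ} {w : ℝ → UnitAddTorus d → ℝ}

/-- A bounded drift of a global weak solution is in `L^∞((0,T) × T^d)` for every horizon (its
measurability is part of the class). -/
theorem memLp_top_drift (hw : IsWeakScalarTransportDiagForced a κ b (fun _ => S) θ₀ w)
    (hbA : ∀ (t : ℝ) (x : UnitAddTorus d), ‖b t x‖ ≤ A) {T : ℝ} (hT : 0 < T) :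
    MemLp (stLift b) ⊤ (volume.restrict (Ioo 0 T ×ˢ univ)) :=
  memLp_top_of_bound (hw T hT).aestronglyMeasurable_velocity A (Eventually.of_forall fun p => by
    obtain ⟨t, y⟩ := p
    simpa only [stLift_apply] using hbA t (proj y))

omit [DecidableEq d] in
/-- A steady `L²` source is in `L¹_t L²_x` on every horizon. -/
theorem lintegral_steady_source_lt_top (hS2 : MemLp S 2 volume) (T : ℝ) :
    ∫⁻ _ in Ioo 0 T, (∫⁻ x, ‖S x‖ₑ ^ 2) ^ (1 / 2 : ℝ) < ⊤ := by
  rw [setLIntegral_const]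
  refine ENNReal.mul_lt_top ?_ measure_Ioo_lt_top
  have h2 : ∫⁻ x, ‖S x‖ₑ ^ 2 < ⊤ := by
    rw [← Torus.ofReal_scalarL2Sq_eq hS2]
    exact ENNReal.ofReal_lt_top
  exact ENNReal.rpow_lt_top_of_nonneg (by norm_num) h2.ne

omit [DecidableEq d] in
/-- `∫_{(t₁,t₂)} ‖S‖_{L²} = (t₂ - t₁) ‖S‖_{L²}` for a steady source. -/
theorem setIntegral_Ioo_const_sqrt (S : UnitAddTorus d → ℝ) {t₁ t₂ : ℝ} (h12 : t₁ ≤ t₂) :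
    ∫ _ in Ioo t₁ t₂, Real.sqrt (∫ x, S x ^ 2) = (t₂ - t₁) * Real.sqrt (∫ x, S x ^ 2) := by
  rw [setIntegral_const, Real.volume_real_Ioo_of_le h12, smul_eq_mul]

/-- **Step 1, growth**: `‖w(t₂)‖_{L²} ≤ ‖w(t₁)‖_{L²} + (t₂ - t₁) ‖S‖_{L²}` for `0 ≤ t₁ ≤ t₂` and
every `L²`-continuous global weak solution with bounded drift and steady `L²` source (the tree's
Duhamel bound `IsWeakScalarTransportDiagForced.sqrt_integral_sq_le_of_isL2ContinuousOn`). -/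
theorem sqrt_integral_sq_le_add_mul (hw : IsWeakScalarTransportDiagForced a κ b (fun _ => S) θ₀ w)
    (hwc : IsL2ContinuousOn (Ici 0) w) (hκ : 0 < κ) (ha : ∀ i, 0 < a i) (hθ₀ : MemLp θ₀ 2 volume)
    (hbA : ∀ (t : ℝ) (x : UnitAddTorus d), ‖b t x‖ ≤ A) (hS2 : MemLp S 2 volume)
    {t₁ t₂ : ℝ} (ht₁ : 0 ≤ t₁) (h12 : t₁ ≤ t₂) :
    Real.sqrt (∫ x, w t₂ x ^ 2) ≤ Real.sqrt (∫ x, w t₁ x ^ 2) + (t₂ - t₁) * Real.sqrt (∫ x, S x ^ 2) := by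
  have key := hw.sqrt_integral_sq_le_of_isL2ContinuousOn hκ ha hθ₀ (fun T hT => memLp_top_drift hw hbA hT)
    (fun T _ => lintegral_steady_source_lt_top hS2 T) hwc ht₁ h12
  rwa [setIntegral_Ioo_const_sqrt S h12] at key

/-- **Step 1, the charge–discharge contraction on the active unit.** Let `w` be an
`L²`-continuous global weak solution with bounded drift `b`, steady smooth source `S`, `κ > 0`,
`aᵢ > 0`, mean-zero `L²` datum and mean-zero `S`; suppose that on the active unit of period `n`
the drift is the field `W`, `b(nL + t) = W(t)` for `t ∈ (0,1)`, and that the homogeneous problem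
with drift `W` contracts mean-zero `L²` data by `q` at time `1` on `L²`-continuous weak solutions
(`hHCR`, the `p = 2` case of Hess-Childs–Rowan Cor. 1.3 (1.3)). Then
`‖w(nL + 1)‖_{L²} ≤ q ‖w(nL)‖_{L²} + ‖S‖_{L²}`: Duhamel splitting `w(nL + ·) = θʰ + θᶠ` with the
`L²`-continuous homogeneous solution `θʰ` from `w(nL)` (`exists_isWeakScalarTransportDiagOn_l2Continuous`)
and the forced remainder `θᶠ` from datum `0` (`sub_homogeneous`), `‖θᶠ(1)‖ ≤ ∫₀¹‖S‖`. -/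
theorem sqrt_integral_sq_activeEnd_le (hw : IsWeakScalarTransportDiagForced a κ b (fun _ => S) θ₀ w)
    (hwc : IsL2ContinuousOn (Ici 0) w) (hκ : 0 < κ) (ha : ∀ i, 0 < a i)
    (hmean : ∫ x, θ₀ x = 0) (hSmean : ∫ x, S x = 0) (hS : IsSmooth S)
    (hbA : ∀ (t : ℝ) (x : UnitAddTorus d), ‖b t x‖ ≤ A) (hq : 0 ≤ q)
    (hHCR : ∀ η₀ : UnitAddTorus d → ℝ, MemLp η₀ 2 volume → ∫ x, η₀ x = 0 →
      ∀ η : ℝ → UnitAddTorus d → ℝ, IsWeakScalarTransportDiagOn 1 a κ W η₀ η →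
        IsL2ContinuousOn (Icc 0 1) η → Torus.scalarL2Sq (η 1) ≤ q ^ 2 * Torus.scalarL2Sq η₀)
    {n : ℕ} (hbW : ∀ t ∈ Ioo (0 : ℝ) 1, b ((n : ℝ) * L + t) = W t) (hL : 0 ≤ L) :
    Real.sqrt (∫ x, w ((n : ℝ) * L + 1) x ^ 2) ≤
      q * Real.sqrt (∫ x, w ((n : ℝ) * L) x ^ 2) + Real.sqrt (∫ x, S x ^ 2) := by
  set σ : ℝ := (n : ℝ) * L with hσdef
  have hσ : 0 ≤ σ := by positivity
  have hS2 : MemLp S 2 volume := hS.memLp 2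
  -- restart at `σ`, horizon `1`
  have hrest := hw.translate_of_isL2ContinuousOn hwc hσ
  have h1 : IsWeakScalarTransportDiagForcedOn 1 a κ (fun t => b (σ + t)) (fun _ => S) (w σ)
      (fun t => w (σ + t)) := hrest 1 one_pos
  have hu1 : MemLp (stLift fun t => b (σ + t)) ⊤ (volume.restrict (Ioo 0 1 ×ˢ univ)) :=
    memLp_top_of_bound h1.aestronglyMeasurable_velocity A (Eventually.of_forall fun p => by
      obtain ⟨t, y⟩ := p
      simpa only [stLift_apply] using hbA (σ + t) (proj y))
  have hwσ : MemLp (w σ) 2 volume := hwc.memLp (mem_Ici.2 hσ)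
  have hs1 : ∫⁻ _ in Ioo (0 : ℝ) 1, (∫⁻ x, ‖S x‖ₑ ^ 2) ^ (1 / 2 : ℝ) < ⊤ := lintegral_steady_source_lt_top hS2 1
  -- the homogeneous part (T2) and the Hess-Childs–Rowan contraction
  obtain ⟨θh, hθh, hθhc, hθh0⟩ :=
    exists_isWeakScalarTransportDiagOn_l2Continuous (a := a) (T := 1) hκ ha hwσ hu1 h1.ae_isWeaklyDivFree
  have hθhW : IsWeakScalarTransportDiagOn 1 a κ W (w σ) θh :=
    hθh.congr_velocity fun t ht => (hbW t ht).symm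
  have hmeanσ : ∫ x, w σ x = 0 :=
    hw.integral_eq_zero_of_isL2ContinuousOn hwc hmean (Eventually.of_forall fun _ => hSmean) hσ
  have hH := hHCR (w σ) hwσ hmeanσ θh hθhW hθhc
  have hh1 : Real.sqrt (∫ x, θh 1 x ^ 2) ≤ q * Real.sqrt (∫ x, w σ x ^ 2) := by
    have e : Real.sqrt (q ^ 2 * Torus.scalarL2Sq (w σ)) = q * Real.sqrt (∫ x, w σ x ^ 2) := by
      rw [Real.sqrt_mul' _ (Torus.scalarL2Sq_nonneg _), Real.sqrt_sq hq]; rfl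
    rw [← e]
    exact Real.sqrt_le_sqrt hH
  -- the forced remainder, from datum `0`, is `L²`-continuous and obeys the Duhamel bound
  set θf : ℝ → UnitAddTorus d → ℝ := fun t x => w (σ + t) x - θh t x with hθfdef
  have hθf : IsWeakScalarTransportDiagForcedOn 1 a κ (fun t => b (σ + t)) (fun _ => S) 0 θf :=
    h1.sub_homogeneous hθh
  have hθfc : IsL2ContinuousOn (Icc 0 1) θf := isL2ContinuousOn_sub (isL2ContinuousOn_shift hwc hσ 1) hθhc
  have h0mem : MemLp (0 : UnitAddTorus d → ℝ) 2 volume := MemLp.zero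
  have hf1 := hθf.sqrt_integral_sq_le_datum_of_isL2ContinuousOn one_pos hκ ha h0mem hu1 hs1 hθfc
    (t := 1) ⟨zero_le_one, le_rfl⟩
  have hf1' : Real.sqrt (∫ x, θf 1 x ^ 2) ≤ Real.sqrt (∫ x, S x ^ 2) := by
    have e0 : ∫ x, (0 : UnitAddTorus d → ℝ) x ^ 2 = 0 := by simp
    rw [e0, Real.sqrt_zero, zero_add, setIntegral_Ioo_const_sqrt S zero_le_one] at hf1
    simpa using hf1
  -- `w(σ + 1) = θʰ(1) + θᶠ(1)` and the triangle inequality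
  have hsum : ∀ x, w (σ + 1) x = θh 1 x + θf 1 x := fun x => by simp [hθfdef]
  have htri := sqrt_integral_add_sq_le (hθhc.memLp ⟨zero_le_one, le_rfl⟩) (hθfc.memLp ⟨zero_le_one, le_rfl⟩)
  have e1 : (∫ x, (θh 1 x + θf 1 x) ^ 2) = ∫ x, w (σ + 1) x ^ 2 :=
    integral_congr_ae (Eventually.of_forall fun x => by
      show (θh 1 x + θf 1 x) ^ 2 = w (σ + 1) x ^ 2
      rw [hsum x])
  rw [e1] at htri
  linarith

end Period

end Summit.AnomalousDissipation.AnomalousDissipation.Theorems.ScalarZerothLawKinematic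

end
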